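/-
Copyright: the b2b-balaban T⁴-continuum CRUX team, row NE7b leaf lineage `t4-ne7b-formalise-leaf-05` (gen 160). Project licence.
-/
import Summits.QuantumFields.BalabanUV.T4Continuum.Spine.NE7b.BlockAverageCriticalSection
import Summits.QuantumFields.BalabanUV.T4Continuum.Spine.NE7b.HardStepSemigroup
import Literature.MathematicalPhysics.QuantumFieldTheory.Balaban1983to89.B5Composition116

/-!
# THE SCALAR HARD FLOW ON THE TORUS IS A SEMIGROUP — print's composition law (1.16) `Q′_m ∘ Q′_n = Q′_{mn}` at the level of
# CRITICAL SECTIONS and EFFECTIVE FORMS: the critical section of `Q′_{mn}` for the level-`(mn, M)` fine form IS (the site map of) the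
# level-`(n, fine m M)` critical section followed by the critical section of `Q′_m` for the TRANSPORTED form, and
# `Q⁺_{(mn,M)} = m^{2−d}·(Q⁺_{(n, fine m M)})⁺` — so the composite-level letters of this lineage's packet (BADD ∕ BAKF ∕ BACS ∕ BAEC ∕
# BAIP ∕ BAUB: «for EVERY side `n`») ARE letters of Bałaban's ITERATED tower, `k` steps of side `L` being ONE step of side `L^k` on the
# nose, with the canonical rescaling `η^d·η^{−2}` per step made explicit (row NE7b, node U5c; [folklore] over `B5Composition116` and
# leaf-03's `…HardStepSemigroup` BY NAME)

Cell `pub-balaban`, sub-cell `t4`, spine estimate NE7b (`T4WeightBudget.RelWeightBound`; the cell's OWN estimate — NOT PRINTED in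
[Bałaban 1983–89], NOT PROVED).  Crux-route work under `Spine/NE7b/` by a row leaf (`t4-ne7b-formalise-leaf-05` gen 160) under FREEZE (0)'s
crux-prover clause; the seventh file of this lineage's hard-flow packet.  NOTHING of Bałaban's is asserted beyond the typed (1.16)
(`B5Composition116.QsOp_comp_mulVec`, `sites`), (1.20) (`B5Block118.QsOp`) and (1.4)∕(1.21) (`B5Action121.GradOp`): the inputs are BACS
(`exists_criticalSection`, `criticalSection_unique`, `criticalFlow_nextFloor`), BAKF (`exists_blockConstant_section`), BADD
(`reM_GradOp_mulVec`), leaf-03's `…HardStepSemigroup.orthogonal_ker_comp` (two hard steps are one — the abstract law), (37)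
`…MatrixFormJunction.exists_map`, `…QuadraticFibreMinimiser.exists_propagator`.  No `T4Continuum/Support` leaf typed; no `def`; zero `sorry`.

WHY.  The packet's letters are stated «for every side `n ≥ 1`», read as the composite blocking `n = L^k` done in ONE averaging `Q′_n`.
Bałaban's flow ITERATES: `k` averagings of side `L`, each followed by the rescaling to the unit lattice, each producing its effective
action by a constrained minimisation.  That the two agree for the free scalar flow is (1.16) plus the semigroup law of constrained
quadratic minimisation (leaf-03's `…HardStepSemigroup`: the critical section of `D₂ ∘ D₁` is the first step's critical section composed
with the critical section of `D₂` for the transported form, by uniqueness).  Here the law is instantiated on print's torus with the one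
subtlety the abstract file cannot see: the two names of the fine torus, `Tor (fine (m·n) M)` (spacing `(mn)⁻¹`) and `Tor (fine n (fine m M))`
(spacing `n⁻¹` over the intermediate unit lattice `Tor (fine m M)`), carry fine forms that differ by the factor `m²∕m^d` — the canonical
rescaling of a scalar field — under the site identification `sites` of `B5Composition116`; critical sections do not see the factor,
effective forms carry it.  Consequently «uniform in `n`» in BADD∕BAUB's (1.67) and BAKF∕BAEC's `(m_P, C_P)` IS «uniform in `k` along the
iterated tower»: the per-step product-of-letters bookkeeping (PRICING-NE7b F689: a factor ≈ 5.5 lost per step) is bypassed exactly as print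
bypasses it — the Gaussian part is carried in closed form.

WHAT IS PROVED ([folklore]; `m, n ≥ 1`, any torus `M`, any `d`; `E₁ = EuclideanSpace ℝ (Tor (fine (m·n) M))`, `E₂ = EuclideanSpace ℝ
(Tor (fine n (fine m M)))`, `F = EuclideanSpace ℝ (Tor (fine m M))`, `G = EuclideanSpace ℝ (Tor M)`; `hQ₁ ∕ hQ₂ ∕ hD₁ ∕ hDn ∕ hDm ∕ hR` = the
packet's coordinate characterisations VERBATIM at the two levels; `hS : (S f)(x) = f(sites x)`):
* §1 `sites_add_unitVec`, `reM_GradOp_mulVec_comp_sites`, `dot_smul_transpose_mul`, **`fineMatrix_dot_comp_sites`** (the fine matrix of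
  level `(mn, M)` read through `sites` is `m²∕m^d` times that of level `(n, fine m M)`), **`reM_QsOp_comp_mulVec`** ((1.16) in real
  clothes), `dot_comp_sites`, `exists_sitesMap`.
* §2 `blocking_sitesMap` (`D₁ (S f) = D_m (D_n f)`), `fineForm_sitesMap` (`Q₁ (S f)(S g) = (m²∕m^d)·Q₂ f g`), `norm_sitesMap` (`‖S f‖ = ‖f‖`),
  `sitesMap_surjective`.
* §3 **`critical_comp`** (`H_n` critical for `(Q₂, D_n)`, `H_m` critical for `(Q₂.bilinearComp H_n H_n, D_m)` ⟹ `S ∘ H_n ∘ H_m` critical for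
  `(Q₁, D₁)`), **`criticalSection_eq_comp`** (ANY critical section `H₁` of `(Q₁, D₁)` EQUALS `S.comp (H_n.comp H_m)`),
  **`effectiveForm_eq_smul_twoStep`** (`Q₁.bilinearComp H₁ H₁ = (m²∕m^d) • (Q₂.bilinearComp H_n H_n).bilinearComp H_m H_m`).
* §4 **`exists_twoStep_criticalSections`** (both steps' critical sections EXIST — the intermediate one because the transported form is
  `(2∕m²)`-coercive on `ker Q′_m`, BACS's level-free next floor), **`exists_semigroup_factorisation`** (everything at once).
* §5 toy: `m²∕m^d = L^{−2} = 1∕4` at `m = L = 2`, `d = 4`.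

NOT HERE (honest): the `k`-fold iterate as an explicit `Fin k`-indexed tower (apply §3 to `(L^j, L)` inductively — bookkeeping only); the
VECTOR law `Q ∘ Q_{k−1} = Q_k` ((1.17), typed in `B5Composition116.QvOp_comp`) for the gauge-field averages; the nonlinear (constrained-
critical) semigroup of leaf-03's §4 for an interacting action; `ℓ²(ℤ^d)`; covariant `U ≠ 1`; anything of Bałaban's small-field action
((A3) ∕ (A1c), NC-NE7b-α UNRULED).  BY-NAME EFFECT ON THE WALL: NONE (the free scalar flow's letters are identified with the iterated
tower's; the wall is (R2)).  NE7b NOT PRINTED ∕ NOT PROVED; spine PROVED 0∕9; rung (B)+1 on a FINITE torus — NOT infinite volume, NOT the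
mass gap, NOT Clay.  HONEST DEPENDENCY: continuum YM on T⁴ ⇐ BetaPertH ∧ nine spine estimates (0∕9 proved); BetaPertH ⇐ (D1) ∧ (D4) ∧
CAP+tail; G-an2-4 gates asym, D1 and NE2∕3∕4.
-/

set_option autoImplicit false

namespace Summit.QuantumFields.BalabanUV.T4Continuum.NE7b.BlockAverageSemigroup

open Matrix WithLp Finset
open Literature.MathematicalPhysics.QuantumFieldTheory.Balaban1983to89
open B5Prop11Plancherel (Tor fine unitVec)
open B5Action121 (GradOp)
open B5Block118 (QsOp)
open B5RealFields (reM cplx isReal_QsOp)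
open B5Composition116 (sites recast recast_add recast_apply fine_fine QsOp_comp_mulVec)
open Summit.QuantumFields.BalabanUV.T4Continuum.NE7b.MatrixFormJunction (exists_map)
open Summit.QuantumFields.BalabanUV.T4Continuum.NE7b.QuadraticFibreMinimiser (exists_propagator)
open Summit.QuantumFields.BalabanUV.T4Continuum.NE7b.HardStepSemigroup (orthogonal_ker_comp)
open Summit.QuantumFields.BalabanUV.T4Continuum.NE7b.BlockAverageDirichletDomination (reM_GradOp_mulVec)
open Summit.QuantumFields.BalabanUV.T4Continuum.NE7b.BlockAverageKernelFloor (exists_blockConstant_section)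
open Summit.QuantumFields.BalabanUV.T4Continuum.NE7b.BlockAverageCriticalSection
  (exists_criticalSection criticalSection_unique criticalFlow_nextFloor)

variable {d : ℕ} (m n : ℕ) [NeZero m] [NeZero n] (M : Fin d → ℕ) [hM : ∀ μ, NeZero (M μ)]

/-! ## §1. The site identification `sites : Tor (fine (m·n) M) ≃ Tor (fine n (fine m M))` transports the three matrices -/

omit [NeZero m] [NeZero n] hM in
/-- `sites (x + e_μ) = sites x + e_μ`: the identification of the two names of the fine torus is a translation-compatible bijection.
[folklore] -/
theorem sites_add_unitVec (x : Tor (fine (m * n) M)) (μ : Fin d) :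
    sites m n M (x + unitVec (fine (m * n) M) μ) = sites m n M x + unitVec (fine n (fine m M)) μ := by
  rw [sites, recast_add]
  congr 1
  funext ν
  rw [recast_apply]
  by_cases hν : ν = μ
  · subst hν; simp [unitVec]
  · simp [unitVec, hν]

/-- The real derivative with lattice factor `c` of a field read through `sites`: `(re ∂_c)(v ∘ sites)(x, μ) = c·(v(sites x + e_μ) − v(sites x))`.
[folklore] -/
theorem reM_GradOp_mulVec_comp_sites (c : ℝ) (v : Tor (fine n (fine m M)) → ℝ) (x : Tor (fine (m * n) M)) (μ : Fin d) :
    (reM (GradOp (fine (m * n) M) (c : ℂ)) *ᵥ (fun x => v (sites m n M x))) (x, μ)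
      = c * (v (sites m n M x + unitVec (fine n (fine m M)) μ) - v (sites m n M x)) := by
  simp only [reM_GradOp_mulVec, sites_add_unitVec]

/-- `x ⬝ ((c·BᵀB) y) = c·Σ_i (Bx)_i (By)_i` for real matrices. [folklore] -/
theorem dot_smul_transpose_mul {ι κ : Type*} [Fintype ι] [Fintype κ] (B : Matrix κ ι ℝ) (c : ℝ) (a b : ι → ℝ) :
    a ⬝ᵥ ((c • (Bᵀ * B)) *ᵥ b) = c * ∑ i, (B *ᵥ a) i * (B *ᵥ b) i := by
  rw [Matrix.smul_mulVec, dotProduct_smul, smul_eq_mul, ← Matrix.mulVec_mulVec, Matrix.dotProduct_mulVec,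
    Matrix.vecMul_transpose]
  rfl

/-- **THE FINE FORM TRANSPORTS WITH THE CANONICAL RESCALING `m^{2−d}`**: the `η^d`-weighted fine Dirichlet matrix of level `(m·n, M)`
(`η = (mn)⁻¹`) read through `sites` is `m²∕m^d` times the fine matrix of level `(n, fine m M)` (`η = n⁻¹`):
`(u ∘ sites) ⬝ A_{(mn,M)} (w ∘ sites) = (m²∕m^d)·(u ⬝ A_{(n, fine m M)} w)`. [folklore] -/
theorem fineMatrix_dot_comp_sites (u w : Tor (fine n (fine m M)) → ℝ) :
    (fun x => u (sites m n M x)) ⬝ᵥ (((1 / ((m * n : ℕ) : ℝ) ^ d) • ((reM (GradOp (fine (m * n) M) ((m * n : ℕ) : ℂ)))ᵀ *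
        reM (GradOp (fine (m * n) M) ((m * n : ℕ) : ℂ)))) *ᵥ fun x => w (sites m n M x))
      = (m : ℝ) ^ 2 / (m : ℝ) ^ d * (u ⬝ᵥ (((1 / (n : ℝ) ^ d) • ((reM (GradOp (fine n (fine m M)) (n : ℂ)))ᵀ *
        reM (GradOp (fine n (fine m M)) (n : ℂ)))) *ᵥ w)) := by
  have h1 : (((m * n : ℕ) : ℝ) : ℂ) = ((m * n : ℕ) : ℂ) := Complex.ofReal_natCast _
  have h2 : ((n : ℝ) : ℂ) = (n : ℂ) := Complex.ofReal_natCast _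
  rw [← h1, ← h2, dot_smul_transpose_mul, dot_smul_transpose_mul, Fintype.sum_prod_type, Fintype.sum_prod_type]
  simp only [reM_GradOp_mulVec, sites_add_unitVec]
  rw [(sites m n M).sum_comp (fun x₂ => ∑ μ : Fin d, ((m * n : ℕ) : ℝ) * (u (x₂ + unitVec (fine n (fine m M)) μ) - u x₂) *
      (((m * n : ℕ) : ℝ) * (w (x₂ + unitVec (fine n (fine m M)) μ) - w x₂)))]
  rw [Finset.mul_sum, Finset.mul_sum, Finset.mul_sum]
  refine Finset.sum_congr rfl fun x₂ _ => ?_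
  rw [Finset.mul_sum, Finset.mul_sum, Finset.mul_sum]
  refine Finset.sum_congr rfl fun μ _ => ?_
  have hm : (m : ℝ) ≠ 0 := by exact_mod_cast NeZero.ne m
  have hn : (n : ℝ) ≠ 0 := by exact_mod_cast NeZero.ne n
  push_cast
  field_simp
  ring

/-- **PRINT's (1.16) IN REAL CLOTHES**: `(re Q′_m)((re Q′_n) v) = (re Q′_{mn})(v ∘ sites)` — averaging the `n`-block means over the
`m`-blocks is the `mn`-block average (`…B5Composition116.QsOp_comp_mulVec` BY NAME). [cite: Balaban1984PropagatorsI, (1.16) p.20] -/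
theorem reM_QsOp_comp_mulVec (v : Tor (fine n (fine m M)) → ℝ) :
    reM (QsOp m M) *ᵥ (reM (QsOp n (fine m M)) *ᵥ v) = reM (QsOp (m * n) M) *ᵥ fun x => v (sites m n M x) := by
  -- complexify (the real action is the complex action on real vectors), use (1.16), read off real parts
  have key : cplx (reM (QsOp m M) *ᵥ (reM (QsOp n (fine m M)) *ᵥ v))
      = cplx (reM (QsOp (m * n) M) *ᵥ fun x => v (sites m n M x)) := by
    rw [(isReal_QsOp m M).cplx_mulVec, (isReal_QsOp n (fine m M)).cplx_mulVec, (isReal_QsOp (m * n) M).cplx_mulVec]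
    funext y
    rw [← QsOp_comp_mulVec m n M (cplx fun x => v (sites m n M x)) y]
    congr 2
    funext x₂
    simp [B5RealFields.cplx_apply, Function.comp]
  funext y
  have h := congrFun key y
  simpa [B5RealFields.cplx_apply] using h

/-- `‖v ∘ sites‖² = ‖v‖²` in `dotProduct` currency. [folklore] -/
theorem dot_comp_sites (u w : Tor (fine n (fine m M)) → ℝ) :
    (fun x => u (sites m n M x)) ⬝ᵥ (fun x => w (sites m n M x)) = u ⬝ᵥ w := by
  simp only [dotProduct]
  exact (sites m n M).sum_comp (fun x₂ => u x₂ * w x₂)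

/-- THE SITE MAP EXISTS as a continuous linear map `S : E₂ →L E₁`, `(S f)(x) = f(sites x)` (`…MatrixFormJunction.exists_map` on the
permutation matrix of `sites`). [folklore] -/
theorem exists_sitesMap :
    ∃ S : EuclideanSpace ℝ (Tor (fine n (fine m M))) →L[ℝ] EuclideanSpace ℝ (Tor (fine (m * n) M)),
      ∀ f x, ofLp (S f) x = ofLp f (sites m n M x) := by
  classical
  obtain ⟨S, hS⟩ := exists_map (ι := Tor (fine n (fine m M))) (κ := Tor (fine (m * n) M))
    (Matrix.of fun x y => if y = sites m n M x then (1 : ℝ) else 0)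
  refine ⟨S, fun f x => ?_⟩
  rw [hS]
  simp only [Matrix.mulVec, dotProduct, Matrix.of_apply, ite_mul, one_mul, zero_mul, Finset.sum_ite_eq',
    Finset.mem_univ, if_true]

/-! ## §2. The three maps read through the site map `S` -/

section Maps

variable {Q₁ : EuclideanSpace ℝ (Tor (fine (m * n) M)) →L[ℝ] EuclideanSpace ℝ (Tor (fine (m * n) M)) →L[ℝ] ℝ}
  {D₁ : EuclideanSpace ℝ (Tor (fine (m * n) M)) →L[ℝ] EuclideanSpace ℝ (Tor M)}
  {Q₂ : EuclideanSpace ℝ (Tor (fine n (fine m M))) →L[ℝ] EuclideanSpace ℝ (Tor (fine n (fine m M))) →L[ℝ] ℝ}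
  {Dn : EuclideanSpace ℝ (Tor (fine n (fine m M))) →L[ℝ] EuclideanSpace ℝ (Tor (fine m M))}
  {Dm : EuclideanSpace ℝ (Tor (fine m M)) →L[ℝ] EuclideanSpace ℝ (Tor M)}
  {S : EuclideanSpace ℝ (Tor (fine n (fine m M))) →L[ℝ] EuclideanSpace ℝ (Tor (fine (m * n) M))}

/-- **THE COMPOSITE BLOCKING IS THE ONE-STEP BLOCKING**: `D₁ (S f) = D_m (D_n f)` — `Q′_{mn}` of the field read on the `(mn)`-torus is
`Q′_m ∘ Q′_n`. [cite: Balaban1984PropagatorsI, (1.16) p.20] -/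
theorem blocking_sitesMap
    (hD₁ : ∀ x, ofLp (D₁ x) = reM (QsOp (m * n) M) *ᵥ ofLp x)
    (hDn : ∀ x, ofLp (Dn x) = reM (QsOp n (fine m M)) *ᵥ ofLp x)
    (hDm : ∀ g, ofLp (Dm g) = reM (QsOp m M) *ᵥ ofLp g)
    (hS : ∀ f x, ofLp (S f) x = ofLp f (sites m n M x)) (f : EuclideanSpace ℝ (Tor (fine n (fine m M)))) :
    D₁ (S f) = Dm (Dn f) := by
  apply WithLp.ofLp_injective 2
  have hSf : ofLp (S f) = fun x => ofLp f (sites m n M x) := funext (hS f)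
  rw [hD₁, hDm, hDn, hSf, reM_QsOp_comp_mulVec]

/-- **THE FINE FORM READ THROUGH `S` IS THE RESCALED FINE FORM**: `Q₁ (S f) (S g) = (m²∕m^d)·Q₂ f g`. [folklore] -/
theorem fineForm_sitesMap
    (hQ₁ : ∀ x y, Q₁ x y = ofLp x ⬝ᵥ (((1 / ((m * n : ℕ) : ℝ) ^ d) • ((reM (GradOp (fine (m * n) M) ((m * n : ℕ) : ℂ)))ᵀ *
        reM (GradOp (fine (m * n) M) ((m * n : ℕ) : ℂ)))) *ᵥ ofLp y))
    (hQ₂ : ∀ x y, Q₂ x y = ofLp x ⬝ᵥ (((1 / (n : ℝ) ^ d) • ((reM (GradOp (fine n (fine m M)) (n : ℂ)))ᵀ *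
        reM (GradOp (fine n (fine m M)) (n : ℂ)))) *ᵥ ofLp y))
    (hS : ∀ f x, ofLp (S f) x = ofLp f (sites m n M x)) (f g : EuclideanSpace ℝ (Tor (fine n (fine m M)))) :
    Q₁ (S f) (S g) = (m : ℝ) ^ 2 / (m : ℝ) ^ d * Q₂ f g := by
  have hSf : ofLp (S f) = fun x => ofLp f (sites m n M x) := funext (hS f)
  have hSg : ofLp (S g) = fun x => ofLp g (sites m n M x) := funext (hS g)
  rw [hQ₁, hQ₂, hSf, hSg, fineMatrix_dot_comp_sites]

/-- `S` is an isometry: `‖S f‖ = ‖f‖`. [folklore] -/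
theorem norm_sitesMap (hS : ∀ f x, ofLp (S f) x = ofLp f (sites m n M x)) (f : EuclideanSpace ℝ (Tor (fine n (fine m M)))) :
    ‖S f‖ = ‖f‖ := by
  have h1 : ‖S f‖ ^ 2 = ofLp (S f) ⬝ᵥ ofLp (S f) := by rw [EuclideanSpace.norm_sq_eq]; simp [dotProduct, sq]
  have h2 : ‖f‖ ^ 2 = ofLp f ⬝ᵥ ofLp f := by rw [EuclideanSpace.norm_sq_eq]; simp [dotProduct, sq]
  have hSf : ofLp (S f) = fun x => ofLp f (sites m n M x) := funext (hS f)
  rw [hSf, dot_comp_sites, ← h2] at h1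
  exact (pow_left_inj₀ (norm_nonneg _) (norm_nonneg _) two_ne_zero).mp h1

omit [NeZero m] [NeZero n] hM in
/-- `S` is onto: every field on the `(mn)`-torus is a field on the `n(m·)`-torus read through `sites`. [folklore] -/
theorem sitesMap_surjective (hS : ∀ f x, ofLp (S f) x = ofLp f (sites m n M x)) (κ : EuclideanSpace ℝ (Tor (fine (m * n) M))) :
    ∃ w : EuclideanSpace ℝ (Tor (fine n (fine m M))), S w = κ := by
  refine ⟨WithLp.toLp 2 fun y => ofLp κ ((sites m n M).symm y), ?_⟩
  apply WithLp.ofLp_injective 2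
  funext x
  rw [hS]
  simp

/-! ## §3. TWO HARD STEPS ARE ONE — for print's block averages on the torus -/

/-- **CRITICALITY COMPOSES THROUGH `S`.**  `H_n` the critical section of `Q′_n` for the level-`(n, fine m M)` fine form `Q₂` and `H_m`
the critical section of `Q′_m` for the transported (effective) form `Q₂.bilinearComp H_n H_n` ⟹ `S ∘ H_n ∘ H_m` is a critical section
of `Q′_{mn}` for the level-`(mn, M)` fine form `Q₁`: a section by (1.16), `Q₁`-orthogonal to `ker Q′_{mn}` by
`…HardStepSemigroup.orthogonal_ker_comp` and §2 (the rescaling factor `m²∕m^d` multiplies a zero). [folklore] -/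
theorem critical_comp
    (hQ₁ : ∀ x y, Q₁ x y = ofLp x ⬝ᵥ (((1 / ((m * n : ℕ) : ℝ) ^ d) • ((reM (GradOp (fine (m * n) M) ((m * n : ℕ) : ℂ)))ᵀ *
        reM (GradOp (fine (m * n) M) ((m * n : ℕ) : ℂ)))) *ᵥ ofLp y))
    (hD₁ : ∀ x, ofLp (D₁ x) = reM (QsOp (m * n) M) *ᵥ ofLp x)
    (hQ₂ : ∀ x y, Q₂ x y = ofLp x ⬝ᵥ (((1 / (n : ℝ) ^ d) • ((reM (GradOp (fine n (fine m M)) (n : ℂ)))ᵀ *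
        reM (GradOp (fine n (fine m M)) (n : ℂ)))) *ᵥ ofLp y))
    (hDn : ∀ x, ofLp (Dn x) = reM (QsOp n (fine m M)) *ᵥ ofLp x)
    (hDm : ∀ g, ofLp (Dm g) = reM (QsOp m M) *ᵥ ofLp g)
    (hS : ∀ f x, ofLp (S f) x = ofLp f (sites m n M x))
    {Hn : EuclideanSpace ℝ (Tor (fine m M)) →L[ℝ] EuclideanSpace ℝ (Tor (fine n (fine m M)))}
    {Hm : EuclideanSpace ℝ (Tor M) →L[ℝ] EuclideanSpace ℝ (Tor (fine m M))}
    (hHn : ∀ k, Dn (Hn k) = k) (hHno : ∀ k κ, Dn κ = 0 → Q₂ (Hn k) κ = 0)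
    (hHm : ∀ g, Dm (Hm g) = g) (hHmo : ∀ g v, Dm v = 0 → (Q₂.bilinearComp Hn Hn) (Hm g) v = 0) :
    (∀ g, D₁ (S (Hn (Hm g))) = g) ∧ (∀ g κ, D₁ κ = 0 → Q₁ (S (Hn (Hm g))) κ = 0) := by
  refine ⟨fun g => by rw [blocking_sitesMap m n M hD₁ hDn hDm hS, hHn, hHm], fun g κ hκ => ?_⟩
  obtain ⟨w, rfl⟩ := sitesMap_surjective m n M hS κ
  rw [blocking_sitesMap m n M hD₁ hDn hDm hS] at hκ
  rw [fineForm_sitesMap m n M hQ₁ hQ₂ hS, orthogonal_ker_comp Q₂ hHn hHno hHmo g w hκ, mul_zero]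

/-- **THE LEVEL-`(mn)` CRITICAL SECTION FACTORS: `H_{(mn,M)} = S ∘ H_n ∘ H_m`.**  ANY critical section `H₁` of `Q′_{mn}` for `Q₁` (BACS
`exists_criticalSection` at level `(mn, M)`) IS the composite of the two steps' critical sections — BACS `criticalSection_unique` at level
`(mn, M)`; no Lax–Milgram at the intermediate scale is compared, the two descriptions are one object. [folklore] -/
theorem criticalSection_eq_comp
    (hQ₁ : ∀ x y, Q₁ x y = ofLp x ⬝ᵥ (((1 / ((m * n : ℕ) : ℝ) ^ d) • ((reM (GradOp (fine (m * n) M) ((m * n : ℕ) : ℂ)))ᵀ *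
        reM (GradOp (fine (m * n) M) ((m * n : ℕ) : ℂ)))) *ᵥ ofLp y))
    (hD₁ : ∀ x, ofLp (D₁ x) = reM (QsOp (m * n) M) *ᵥ ofLp x)
    (hQ₂ : ∀ x y, Q₂ x y = ofLp x ⬝ᵥ (((1 / (n : ℝ) ^ d) • ((reM (GradOp (fine n (fine m M)) (n : ℂ)))ᵀ *
        reM (GradOp (fine n (fine m M)) (n : ℂ)))) *ᵥ ofLp y))
    (hDn : ∀ x, ofLp (Dn x) = reM (QsOp n (fine m M)) *ᵥ ofLp x)
    (hDm : ∀ g, ofLp (Dm g) = reM (QsOp m M) *ᵥ ofLp g)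
    (hS : ∀ f x, ofLp (S f) x = ofLp f (sites m n M x))
    {Hn : EuclideanSpace ℝ (Tor (fine m M)) →L[ℝ] EuclideanSpace ℝ (Tor (fine n (fine m M)))}
    {Hm : EuclideanSpace ℝ (Tor M) →L[ℝ] EuclideanSpace ℝ (Tor (fine m M))}
    (hHn : ∀ k, Dn (Hn k) = k) (hHno : ∀ k κ, Dn κ = 0 → Q₂ (Hn k) κ = 0)
    (hHm : ∀ g, Dm (Hm g) = g) (hHmo : ∀ g v, Dm v = 0 → (Q₂.bilinearComp Hn Hn) (Hm g) v = 0)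
    {H₁ : EuclideanSpace ℝ (Tor M) →L[ℝ] EuclideanSpace ℝ (Tor (fine (m * n) M))}
    (hH₁ : ∀ g, D₁ (H₁ g) = g) (hH₁o : ∀ g κ, D₁ κ = 0 → Q₁ (H₁ g) κ = 0) :
    H₁ = S.comp (Hn.comp Hm) := by
  obtain ⟨hsec, horth⟩ := critical_comp m n M hQ₁ hD₁ hQ₂ hDn hDm hS hHn hHno hHm hHmo
  exact criticalSection_unique (m * n) M hQ₁ hD₁ hH₁ hH₁o (fun g => by simpa using hsec g)
    (fun g κ hκ => by simpa using horth g κ hκ)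

/-- **THE LEVEL-`(mn)` EFFECTIVE FORM IS ONE HARD STEP OF THE RESCALED LEVEL-`n` EFFECTIVE FORM**:
`Q₁.bilinearComp H₁ H₁ = (m²∕m^d) • (Q₂.bilinearComp H_n H_n).bilinearComp H_m H_m` — `Q⁺_{(mn,M)} = m^{2−d}·(Q⁺_{(n, fine m M)})⁺`,
the canonical rescaling `η^d·η^{−2}` of a `d`-dimensional scalar field at `η = m⁻¹` made explicit. [folklore] -/
theorem effectiveForm_eq_smul_twoStep
    (hQ₁ : ∀ x y, Q₁ x y = ofLp x ⬝ᵥ (((1 / ((m * n : ℕ) : ℝ) ^ d) • ((reM (GradOp (fine (m * n) M) ((m * n : ℕ) : ℂ)))ᵀ *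
        reM (GradOp (fine (m * n) M) ((m * n : ℕ) : ℂ)))) *ᵥ ofLp y))
    (hD₁ : ∀ x, ofLp (D₁ x) = reM (QsOp (m * n) M) *ᵥ ofLp x)
    (hQ₂ : ∀ x y, Q₂ x y = ofLp x ⬝ᵥ (((1 / (n : ℝ) ^ d) • ((reM (GradOp (fine n (fine m M)) (n : ℂ)))ᵀ *
        reM (GradOp (fine n (fine m M)) (n : ℂ)))) *ᵥ ofLp y))
    (hDn : ∀ x, ofLp (Dn x) = reM (QsOp n (fine m M)) *ᵥ ofLp x)
    (hDm : ∀ g, ofLp (Dm g) = reM (QsOp m M) *ᵥ ofLp g)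
    (hS : ∀ f x, ofLp (S f) x = ofLp f (sites m n M x))
    {Hn : EuclideanSpace ℝ (Tor (fine m M)) →L[ℝ] EuclideanSpace ℝ (Tor (fine n (fine m M)))}
    {Hm : EuclideanSpace ℝ (Tor M) →L[ℝ] EuclideanSpace ℝ (Tor (fine m M))}
    (hHn : ∀ k, Dn (Hn k) = k) (hHno : ∀ k κ, Dn κ = 0 → Q₂ (Hn k) κ = 0)
    (hHm : ∀ g, Dm (Hm g) = g) (hHmo : ∀ g v, Dm v = 0 → (Q₂.bilinearComp Hn Hn) (Hm g) v = 0)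
    {H₁ : EuclideanSpace ℝ (Tor M) →L[ℝ] EuclideanSpace ℝ (Tor (fine (m * n) M))}
    (hH₁ : ∀ g, D₁ (H₁ g) = g) (hH₁o : ∀ g κ, D₁ κ = 0 → Q₁ (H₁ g) κ = 0) :
    Q₁.bilinearComp H₁ H₁ = ((m : ℝ) ^ 2 / (m : ℝ) ^ d) • (Q₂.bilinearComp Hn Hn).bilinearComp Hm Hm := by
  rw [criticalSection_eq_comp m n M hQ₁ hD₁ hQ₂ hDn hDm hS hHn hHno hHm hHmo hH₁ hH₁o]
  ext g g'
  simp only [ContinuousLinearMap.bilinearComp_apply, ContinuousLinearMap.coe_comp, Function.comp_apply,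
    _root_.smul_apply, smul_eq_mul]
  exact fineForm_sitesMap m n M hQ₁ hQ₂ hS _ _

end Maps

/-! ## §4. Both steps' critical sections EXIST (BACS at level `(n, fine m M)`; QFM at the intermediate scale with BACS's next floor `2∕m²`) -/

/-- **THE TWO STEPS' CRITICAL SECTIONS EXIST.**  `H_n`: BACS `exists_criticalSection` at level `(n, fine m M)`.  `H_m`: the transported
form `Q₂.bilinearComp H_n H_n` is `(2∕m²)`-coercive on `ker Q′_m` (BACS `criticalFlow_nextFloor` — the level-free next floor, `R` the
unit-lattice Dirichlet form of the intermediate torus), so `…QuadraticFibreMinimiser.exists_propagator` (auxiliary right inverse: BAKF's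
block-constant section of `Q′_m`) gives its critical section. [folklore] -/
theorem exists_twoStep_criticalSections
    {Q₂ : EuclideanSpace ℝ (Tor (fine n (fine m M))) →L[ℝ] EuclideanSpace ℝ (Tor (fine n (fine m M))) →L[ℝ] ℝ}
    {R : EuclideanSpace ℝ (Tor (fine m M)) →L[ℝ] EuclideanSpace ℝ (Tor (fine m M)) →L[ℝ] ℝ}
    {Dn : EuclideanSpace ℝ (Tor (fine n (fine m M))) →L[ℝ] EuclideanSpace ℝ (Tor (fine m M))}
    {Dm : EuclideanSpace ℝ (Tor (fine m M)) →L[ℝ] EuclideanSpace ℝ (Tor M)}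
    (hQ₂ : ∀ x y, Q₂ x y = ofLp x ⬝ᵥ (((1 / (n : ℝ) ^ d) • ((reM (GradOp (fine n (fine m M)) (n : ℂ)))ᵀ *
        reM (GradOp (fine n (fine m M)) (n : ℂ)))) *ᵥ ofLp y))
    (hR : ∀ g h, R g h = ofLp g ⬝ᵥ (((reM (GradOp (fine m M) 1))ᵀ * reM (GradOp (fine m M) 1)) *ᵥ ofLp h))
    (hDn : ∀ x, ofLp (Dn x) = reM (QsOp n (fine m M)) *ᵥ ofLp x)
    (hDm : ∀ g, ofLp (Dm g) = reM (QsOp m M) *ᵥ ofLp g) :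
    ∃ (Hn : EuclideanSpace ℝ (Tor (fine m M)) →L[ℝ] EuclideanSpace ℝ (Tor (fine n (fine m M))))
      (Hm : EuclideanSpace ℝ (Tor M) →L[ℝ] EuclideanSpace ℝ (Tor (fine m M))),
      (∀ k, Dn (Hn k) = k) ∧ (∀ k κ, Dn κ = 0 → Q₂ (Hn k) κ = 0) ∧
      (∀ g, Dm (Hm g) = g) ∧ (∀ g v, Dm v = 0 → (Q₂.bilinearComp Hn Hn) (Hm g) v = 0) := by
  obtain ⟨Hn, hHn, hHno⟩ := exists_criticalSection n (fine m M) hQ₂ hDn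
  obtain ⟨T₀, -, hT₀⟩ := exists_blockConstant_section m M hDm
  have hm : (0 : ℝ) < 2 / (m : ℝ) ^ 2 :=
    div_pos two_pos (pow_pos (Nat.cast_pos.mpr (Nat.pos_of_ne_zero (NeZero.ne m))) 2)
  have hco : ∀ g, Dm g = 0 → 2 / (m : ℝ) ^ 2 * ‖g‖ ^ 2 ≤ (Q₂.bilinearComp Hn Hn) g g :=
    fun g hg => criticalFlow_nextFloor n m M hQ₂ hR hDn hHn hDm g hg
  obtain ⟨Hm, hHm, hHmo, -⟩ := exists_propagator (Q := Q₂.bilinearComp Hn Hn) hT₀ hm hco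
  exact ⟨Hn, Hm, hHn, hHno, hHm, hHmo⟩

/-- **THE SCALAR TORUS HARD FLOW IS A SEMIGROUP — EVERYTHING DISCHARGED BUT THE FIVE COORDINATE LETTERS.**  For the fine forms `Q₁`
(level `(mn, M)`), `Q₂` (level `(n, fine m M)`), the unit Dirichlet form `R` of the intermediate torus and print's block averages
`D₁ = Q′_{mn}`, `D_n = Q′_n`, `D_m = Q′_m` in coordinates, and ANY critical section `H₁` of `D₁` for `Q₁`: THERE ARE the site map `S`, the
level-`n` critical section `H_n` and the intermediate critical section `H_m` with `H₁ = S ∘ H_n ∘ H_m` and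
`Q₁.bilinearComp H₁ H₁ = (m²∕m^d) • (Q₂.bilinearComp H_n H_n).bilinearComp H_m H_m`. [folklore] -/
theorem exists_semigroup_factorisation
    {Q₁ : EuclideanSpace ℝ (Tor (fine (m * n) M)) →L[ℝ] EuclideanSpace ℝ (Tor (fine (m * n) M)) →L[ℝ] ℝ}
    {D₁ : EuclideanSpace ℝ (Tor (fine (m * n) M)) →L[ℝ] EuclideanSpace ℝ (Tor M)}
    {Q₂ : EuclideanSpace ℝ (Tor (fine n (fine m M))) →L[ℝ] EuclideanSpace ℝ (Tor (fine n (fine m M))) →L[ℝ] ℝ}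
    {R : EuclideanSpace ℝ (Tor (fine m M)) →L[ℝ] EuclideanSpace ℝ (Tor (fine m M)) →L[ℝ] ℝ}
    {Dn : EuclideanSpace ℝ (Tor (fine n (fine m M))) →L[ℝ] EuclideanSpace ℝ (Tor (fine m M))}
    {Dm : EuclideanSpace ℝ (Tor (fine m M)) →L[ℝ] EuclideanSpace ℝ (Tor M)}
    (hQ₁ : ∀ x y, Q₁ x y = ofLp x ⬝ᵥ (((1 / ((m * n : ℕ) : ℝ) ^ d) • ((reM (GradOp (fine (m * n) M) ((m * n : ℕ) : ℂ)))ᵀ *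
        reM (GradOp (fine (m * n) M) ((m * n : ℕ) : ℂ)))) *ᵥ ofLp y))
    (hD₁ : ∀ x, ofLp (D₁ x) = reM (QsOp (m * n) M) *ᵥ ofLp x)
    (hQ₂ : ∀ x y, Q₂ x y = ofLp x ⬝ᵥ (((1 / (n : ℝ) ^ d) • ((reM (GradOp (fine n (fine m M)) (n : ℂ)))ᵀ *
        reM (GradOp (fine n (fine m M)) (n : ℂ)))) *ᵥ ofLp y))
    (hR : ∀ g h, R g h = ofLp g ⬝ᵥ (((reM (GradOp (fine m M) 1))ᵀ * reM (GradOp (fine m M) 1)) *ᵥ ofLp h))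
    (hDn : ∀ x, ofLp (Dn x) = reM (QsOp n (fine m M)) *ᵥ ofLp x)
    (hDm : ∀ g, ofLp (Dm g) = reM (QsOp m M) *ᵥ ofLp g)
    {H₁ : EuclideanSpace ℝ (Tor M) →L[ℝ] EuclideanSpace ℝ (Tor (fine (m * n) M))}
    (hH₁ : ∀ g, D₁ (H₁ g) = g) (hH₁o : ∀ g κ, D₁ κ = 0 → Q₁ (H₁ g) κ = 0) :
    ∃ (S : EuclideanSpace ℝ (Tor (fine n (fine m M))) →L[ℝ] EuclideanSpace ℝ (Tor (fine (m * n) M)))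
      (Hn : EuclideanSpace ℝ (Tor (fine m M)) →L[ℝ] EuclideanSpace ℝ (Tor (fine n (fine m M))))
      (Hm : EuclideanSpace ℝ (Tor M) →L[ℝ] EuclideanSpace ℝ (Tor (fine m M))),
      (∀ f x, ofLp (S f) x = ofLp f (sites m n M x)) ∧
      (∀ k, Dn (Hn k) = k) ∧ (∀ k κ, Dn κ = 0 → Q₂ (Hn k) κ = 0) ∧
      (∀ g, Dm (Hm g) = g) ∧ (∀ g v, Dm v = 0 → (Q₂.bilinearComp Hn Hn) (Hm g) v = 0) ∧
      H₁ = S.comp (Hn.comp Hm) ∧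
      Q₁.bilinearComp H₁ H₁ = ((m : ℝ) ^ 2 / (m : ℝ) ^ d) • (Q₂.bilinearComp Hn Hn).bilinearComp Hm Hm := by
  obtain ⟨S, hS⟩ := exists_sitesMap m n M
  obtain ⟨Hn, Hm, hHn, hHno, hHm, hHmo⟩ := exists_twoStep_criticalSections m n M hQ₂ hR hDn hDm
  exact ⟨S, Hn, Hm, hS, hHn, hHno, hHm, hHmo,
    criticalSection_eq_comp m n M hQ₁ hD₁ hQ₂ hDn hDm hS hHn hHno hHm hHmo hH₁ hH₁o,
    effectiveForm_eq_smul_twoStep m n M hQ₁ hD₁ hQ₂ hDn hDm hS hHn hHno hHm hHmo hH₁ hH₁o⟩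

/-! ## §5. Toy -/

/-- Toy: the rescaling factor `m²∕m^d` at `m = L = 2`, `d = 4` is `L^{−2} = 1∕4` — the free field's per-step factor. -/
example : (2 : ℝ) ^ 2 / (2 : ℝ) ^ 4 = 1 / 4 := by norm_num

end Summit.QuantumFields.BalabanUV.T4Continuum.NE7b.BlockAverageSemigroup
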